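import Literature.NumberTheory.GaloisRepresentations.AbsIntegersEquiv
import Literature.NumberTheory.GaloisRepresentations.ModNCyclotomicCharacter
import Literature.NumberTheory.Automorphic.GaloisActionPlaces
import Mathlib.NumberTheory.Cyclotomic.Gal
import HarnessLib

/-!
# Places of `ℚ(ζ_m)` and primes of `\bar ℤ`: the `Γ_ℚ`-action on primes above `p` is the
# `Gal(ℚ(ζ_m)/ℚ)`-action on places through the mod-`m` cyclotomic character

Topic `NumberTheory/GaloisRepresentations` (companion of `AbsIntegersEquiv`, `ModNCyclotomicCharacter`,
`CyclotomicDecompositionFrobenius`; uses the action on places of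
`Literature.NumberTheory.Automorphic.GaloisActionPlaces`).  `Proofs` file: theorems only, no
definitions, no named facts.  `L = CyclotomicField m ℚ`, `ι = absClosureEmbedding ℚ L : ℚ̄ → L̄` the
tree's chosen embedding (bijective, `L/ℚ` algebraic), `\bar ℤ_ℚ ≅ \bar ℤ_L` along it
(`absIntegersEquiv ℚ L`), and for `γ ∈ Γ_ℚ` let `γ̃ ∈ Gal(L/ℚ)` be the automorphism `ζ ↦ ζ^{χ_m(γ)}`
(`(autEquivPow L _).symm (modNCyclotomicCharacter ℚ m γ)` — the `sigma m (χ_m γ)` of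
`Kato2004.EulerSystemValues`).

* `CyclotomicField.algEquiv_mul_comm` — `Gal(L/ℚ)` is commutative (through `autEquivPow`).
* `CyclotomicField.smul_place_eq_iff_of_under_eq` — all places of `L` above one place of `ℚ` have
  the SAME stabiliser in `Gal(L/ℚ)` (transitivity, Mathlib `Ideal.exists_smul_eq_of_isGaloisGroup` via
  `GaloisActionPlaces.exists_algEquiv_smul_eq`, and commutativity).
* `CyclotomicField.absClosureEmbedding_smul` — **`Γ_ℚ` acts on the copy `ι⁻¹(L) ⊂ ℚ̄` through `γ̃`**:
  `ι t = y ⟹ ι (γ • t) = γ̃ y` for `y ∈ L` (both sides are `ℚ`-algebra maps `L → L̄` agreeing on `ζ`,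
  where it is the defining property of `χ_m`; Mathlib `PowerBasis.algHom_ext`).
* `CyclotomicField.under_comap_smul` — hence **the place of `L` under the prime `ι_*(γ • 𝔓)` is
  `γ̃ •` (the place under `ι_* 𝔓`)**: for an ideal `𝔓` of `\bar ℤ_ℚ`,
  `(ι_*(γ • 𝔓)) ∩ 𝓞 L = γ̃ • ((ι_* 𝔓) ∩ 𝓞 L)`, `ι_* 𝔓 := 𝔓.comap ι⁻¹`.

Consumer: the reduction «`Stab_{Gal(L/ℚ)}(w₀) ⊆ D_{𝔓₀} · Gal(ℚ̄/ℚ(μ_m))`» at EVERY level `m`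
(ramified `p ∣ m` included), by transitivity of `Γ_L` on the primes of `\bar ℤ_L` above a place
(`exists_smul_eq_of_mem_primesAbove`), for the (GAL₀) clause of the single-completion `exp*` value
datum (cell `bsd-addord`, crux `KatoKuriharaPortThreeShared`).

## References
* [NeukirchANT1999] J. Neukirch, *Algebraic Number Theory* (1999), Ch. I §9 (9.1)–(9.3)
  (conjugate primes, decomposition groups), Ch. II §9 (9.6).
* [Washington1997] L. C. Washington, *Introduction to Cyclotomic Fields* (1997), Thm. 2.5, Thm. 2.13.
-/

noncomputable section

open scoped NumberField Pointwise
open Field NumberField IsDedekindDomain Polynomial Literature.NumberTheory.Automorphic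

namespace Literature.NumberTheory.GaloisRepresentations

variable {m : ℕ} [NeZero m]

/-! ## `Gal(ℚ(ζ_m)/ℚ)` is abelian; stabilisers of places above `p` coincide -/

set_option backward.isDefEq.respectTransparency false in
/-- `Gal(ℚ(ζ_m)/ℚ)` is commutative (it embeds into `(ℤ/m)ˣ`, Mathlib `autEquivPow`).
[cite: Washington1997, Thm. 2.5] -/
theorem CyclotomicField.algEquiv_mul_comm (γ₁ γ₂ : CyclotomicField m ℚ ≃ₐ[ℚ] CyclotomicField m ℚ) :
    γ₁ * γ₂ = γ₂ * γ₁ := by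
  apply (IsCyclotomicExtension.autEquivPow (CyclotomicField m ℚ)
    (cyclotomic.irreducible_rat (NeZero.pos m))).injective
  rw [map_mul, map_mul, mul_comm]

set_option backward.isDefEq.respectTransparency false in
/-- **All places of `ℚ(ζ_m)` above one place of `ℚ` have the same stabiliser** (the decomposition
group does not depend on the prime: the group is abelian and acts transitively on the primes above
`v`). [cite: NeukirchANT1999, Ch. I §9 (9.1)–(9.3)] -/
theorem CyclotomicField.smul_place_eq_iff_of_under_eq
    {w w' : HeightOneSpectrum (𝓞 (CyclotomicField m ℚ))} (h : w.under (𝓞 ℚ) = w'.under (𝓞 ℚ))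
    (γ : CyclotomicField m ℚ ≃ₐ[ℚ] CyclotomicField m ℚ) : γ • w = w ↔ γ • w' = w' := by
  haveI := IsCyclotomicExtension.isGalois {m} ℚ (CyclotomicField m ℚ)
  obtain ⟨σ, rfl⟩ := HeightOneSpectrum.exists_algEquiv_smul_eq ℚ h
  rw [smul_smul, CyclotomicField.algEquiv_mul_comm γ σ, ← smul_smul]
  exact ⟨fun hw => by rw [hw], fun hw => smul_left_cancel σ hw⟩

/-! ## `Γ_ℚ` acts on `ι⁻¹(L)` through `γ̃ = (ζ ↦ ζ^{χ_m(γ)})` -/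

omit [NeZero m] in
set_option backward.isDefEq.respectTransparency false in
/-- The chosen embedding `ι : ℚ̄ → L̄`, `L = ℚ(ζ_m)`, is bijective (`L/ℚ` is algebraic: an algebraic
closure of `L` is one of `ℚ`, and `ℚ`-embeddings between algebraic closures are isomorphisms).
[cite: MilneFT2022, Ch. 6 (Prop. 6.8, Cor. 6.9: uniqueness of the algebraic closure)] -/
theorem CyclotomicField.absClosureEmbedding_bijective :
    Function.Bijective (absClosureEmbedding ℚ (CyclotomicField m ℚ)) := by
  letI := absClosureAlgebra ℚ (CyclotomicField m ℚ)
  haveI := absClosure_isScalarTower ℚ (CyclotomicField m ℚ)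
  haveI : Algebra.IsAlgebraic (AlgebraicClosure ℚ) (AlgebraicClosure (CyclotomicField m ℚ)) :=
    Algebra.IsAlgebraic.tower_top (K := ℚ) (AlgebraicClosure ℚ)
  exact IsAlgClosed.algebraMap_bijective_of_isIntegral (k := AlgebraicClosure ℚ)
    (K := AlgebraicClosure (CyclotomicField m ℚ))

set_option backward.isDefEq.respectTransparency false in
/-- **`Γ_ℚ` acts on the copy of `L = ℚ(ζ_m)` inside `ℚ̄` through `γ̃ : ζ ↦ ζ^{χ_m(γ)}`**: if
`ι t = y ∈ L` (`ι` the chosen `ℚ̄ → L̄`) then `ι (γ • t) = γ̃ y`, `γ̃ = autEquivPow⁻¹ (χ_m γ)`.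
(Both sides are `ℚ`-algebra maps `L → L̄` in `y`, and they agree on `ζ_m`, where the identity is the
defining property `γ • ζ₀ = ζ₀^{χ_m(γ)}` of the cyclotomic character.) [cite: Washington1997, Thm. 2.5] -/
theorem CyclotomicField.absClosureEmbedding_smul (γ : absoluteGaloisGroup ℚ) (t : AlgebraicClosure ℚ)
    (y : CyclotomicField m ℚ)
    (h : absClosureEmbedding ℚ (CyclotomicField m ℚ) t =
      algebraMap (CyclotomicField m ℚ) (AlgebraicClosure (CyclotomicField m ℚ)) y) :
    absClosureEmbedding ℚ (CyclotomicField m ℚ) (γ • t) =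
      algebraMap (CyclotomicField m ℚ) (AlgebraicClosure (CyclotomicField m ℚ))
        ((IsCyclotomicExtension.autEquivPow (CyclotomicField m ℚ)
          (cyclotomic.irreducible_rat (NeZero.pos m))).symm (modNCyclotomicCharacter ℚ m γ) y) := by
  let ιe : AlgebraicClosure ℚ ≃ₐ[ℚ] AlgebraicClosure (CyclotomicField m ℚ) :=
    AlgEquiv.ofBijective (absClosureEmbedding ℚ (CyclotomicField m ℚ))
      CyclotomicField.absClosureEmbedding_bijective
  have hιe : ∀ x, ιe x = absClosureEmbedding ℚ (CyclotomicField m ℚ) x := fun _ => rfl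
  set σt : CyclotomicField m ℚ ≃ₐ[ℚ] CyclotomicField m ℚ :=
    (IsCyclotomicExtension.autEquivPow (CyclotomicField m ℚ)
      (cyclotomic.irreducible_rat (NeZero.pos m))).symm (modNCyclotomicCharacter ℚ m γ) with hσt
  -- the two `ℚ`-algebra maps `L → L̄`
  let e : CyclotomicField m ℚ →ₐ[ℚ] AlgebraicClosure (CyclotomicField m ℚ) :=
    IsScalarTower.toAlgHom ℚ (CyclotomicField m ℚ) (AlgebraicClosure (CyclotomicField m ℚ))
  let f₁ : CyclotomicField m ℚ →ₐ[ℚ] AlgebraicClosure (CyclotomicField m ℚ) :=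
    ιe.toAlgHom.comp ((γ : AlgebraicClosure ℚ ≃ₐ[ℚ] AlgebraicClosure ℚ).toAlgHom.comp
      (ιe.symm.toAlgHom.comp e))
  let f₂ : CyclotomicField m ℚ →ₐ[ℚ] AlgebraicClosure (CyclotomicField m ℚ) :=
    e.comp (σt : CyclotomicField m ℚ →ₐ[ℚ] CyclotomicField m ℚ)
  have hζ := IsCyclotomicExtension.zeta_spec m ℚ (CyclotomicField m ℚ)
  -- `ζ₀ := ι⁻¹(ζ)` is a primitive `m`-th root of unity of `ℚ̄`
  have hζ₀ : IsPrimitiveRoot (ιe.symm (e (IsCyclotomicExtension.zeta m ℚ (CyclotomicField m ℚ)))) m :=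
    hζ.map_of_injective (f := ιe.symm.toAlgHom.comp e)
      (ιe.symm.injective.comp (algebraMap (CyclotomicField m ℚ) _).injective)
  have hf : f₁ = f₂ := by
    refine (hζ.powerBasis ℚ).algHom_ext ?_
    rw [IsPrimitiveRoot.powerBasis_gen]
    change ιe (γ • ιe.symm (e (IsCyclotomicExtension.zeta m ℚ (CyclotomicField m ℚ)))) =
      e (σt (IsCyclotomicExtension.zeta m ℚ (CyclotomicField m ℚ)))
    rw [modNCyclotomicCharacter_spec ℚ m γ _ hζ₀.pow_eq_one, map_pow, AlgEquiv.apply_symm_apply,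
      ← map_pow]
    congr 1
    -- `σt ζ = ζ ^ χ(γ)`
    have key := hζ.autToPow_spec ℚ σt
    rw [← key]
    congr 2
    have h1 : IsCyclotomicExtension.autEquivPow (CyclotomicField m ℚ)
        (cyclotomic.irreducible_rat (NeZero.pos m)) σt = modNCyclotomicCharacter ℚ m γ := by
      rw [hσt, MulEquiv.apply_symm_apply]
    exact (congrArg Units.val h1).symm
  -- `t = ι⁻¹ y`
  have ht : t = ιe.symm (e y) := by
    apply ιe.injective
    rw [AlgEquiv.apply_symm_apply, hιe, h]
    rfl
  have hfy := congrArg (fun f : CyclotomicField m ℚ →ₐ[ℚ] AlgebraicClosure (CyclotomicField m ℚ) => f y) hf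
  change ιe (γ • ιe.symm (e y)) = e (σt y) at hfy
  rw [ht, ← hιe, hfy]
  rfl

/-! ## The place under `ι_*(γ • 𝔓)` is `γ̃ •` the place under `ι_* 𝔓` -/

set_option backward.isDefEq.respectTransparency false in
/-- **The dictionary between primes of `\bar ℤ_ℚ` and places of `L = ℚ(ζ_m)`**: transporting an ideal
`𝔓` of `\bar ℤ_ℚ` to `\bar ℤ_L` along `ι` (`ι_* 𝔓 := 𝔓.comap ι⁻¹`, `absIntegersEquiv`) and contracting
to `𝓞 L`, the `Γ_ℚ`-action becomes the `Gal(L/ℚ)`-action through `γ̃`: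
`(ι_*(γ • 𝔓)) ∩ 𝓞 L = γ̃ • ((ι_* 𝔓) ∩ 𝓞 L)`. [cite: NeukirchANT1999, Ch. I §9 (9.1)–(9.3)] -/
theorem CyclotomicField.under_comap_smul (γ : absoluteGaloisGroup ℚ)
    (𝔓 : Ideal (absIntegers (𝓞 ℚ) ℚ)) :
    ((γ • 𝔓).comap ((absIntegersEquiv ℚ (CyclotomicField m ℚ)).symm :
        absIntegers (𝓞 (CyclotomicField m ℚ)) (CyclotomicField m ℚ) →+* absIntegers (𝓞 ℚ) ℚ)).under
      (𝓞 (CyclotomicField m ℚ)) =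
    (IsCyclotomicExtension.autEquivPow (CyclotomicField m ℚ)
        (cyclotomic.irreducible_rat (NeZero.pos m))).symm (modNCyclotomicCharacter ℚ m γ) •
      (𝔓.comap ((absIntegersEquiv ℚ (CyclotomicField m ℚ)).symm :
        absIntegers (𝓞 (CyclotomicField m ℚ)) (CyclotomicField m ℚ) →+* absIntegers (𝓞 ℚ) ℚ)).under
      (𝓞 (CyclotomicField m ℚ)) := by
  set σt := (IsCyclotomicExtension.autEquivPow (CyclotomicField m ℚ)
    (cyclotomic.irreducible_rat (NeZero.pos m))).symm (modNCyclotomicCharacter ℚ m γ) with hσt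
  set ιi := ((absIntegersEquiv ℚ (CyclotomicField m ℚ)).symm :
    absIntegers (𝓞 (CyclotomicField m ℚ)) (CyclotomicField m ℚ) →+* absIntegers (𝓞 ℚ) ℚ) with hιi
  -- the key identity: `ι⁻¹ (σ̃⁻¹ x) = γ⁻¹ • ι⁻¹ x` for `x ∈ 𝓞 L`
  have h1 : ∀ z : absIntegers (𝓞 (CyclotomicField m ℚ)) (CyclotomicField m ℚ),
      absIntegersEquiv ℚ (CyclotomicField m ℚ) (ιi z) = z := fun z => by
    rw [hιi]; exact (absIntegersEquiv ℚ (CyclotomicField m ℚ)).apply_symm_apply z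
  have hcoe : ∀ z : 𝓞 (CyclotomicField m ℚ),
      ((algebraMap (𝓞 (CyclotomicField m ℚ))
        (absIntegers (𝓞 (CyclotomicField m ℚ)) (CyclotomicField m ℚ)) z :
          absIntegers (𝓞 (CyclotomicField m ℚ)) (CyclotomicField m ℚ)) :
        AlgebraicClosure (CyclotomicField m ℚ)) =
      algebraMap (CyclotomicField m ℚ) (AlgebraicClosure (CyclotomicField m ℚ)) (z : CyclotomicField m ℚ) :=
    fun z => by
      rw [SubalgebraClass.coe_algebraMap,
        IsScalarTower.algebraMap_apply (𝓞 (CyclotomicField m ℚ)) (CyclotomicField m ℚ)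
          (AlgebraicClosure (CyclotomicField m ℚ))]
  have hσinv : (IsCyclotomicExtension.autEquivPow (CyclotomicField m ℚ)
      (cyclotomic.irreducible_rat (NeZero.pos m))).symm (modNCyclotomicCharacter ℚ m γ⁻¹) = σt⁻¹ := by
    rw [hσt, map_inv, map_inv]
  have hkey : ∀ x : 𝓞 (CyclotomicField m ℚ),
      ιi (algebraMap (𝓞 (CyclotomicField m ℚ)) (absIntegers (𝓞 (CyclotomicField m ℚ)) (CyclotomicField m ℚ))
        (σt⁻¹ • x)) =
      γ⁻¹ • ιi (algebraMap (𝓞 (CyclotomicField m ℚ))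
        (absIntegers (𝓞 (CyclotomicField m ℚ)) (CyclotomicField m ℚ)) x) := by
    intro x
    apply (absIntegersEquiv ℚ (CyclotomicField m ℚ)).injective
    rw [h1]
    apply Subtype.ext
    rw [hcoe, absIntegersEquiv_apply, coe_absIntegersMap, RingOfIntegers.coe_algEquiv_smul]
    change _ = absClosureEmbedding ℚ (CyclotomicField m ℚ) (γ⁻¹ • (ιi (algebraMap _ _ x) :
      AlgebraicClosure ℚ))
    rw [CyclotomicField.absClosureEmbedding_smul γ⁻¹ _ (x : CyclotomicField m ℚ) ?_, hσinv,
      AlgEquiv.aut_inv]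
    -- `ι (ι⁻¹ x) = x`
    have h2 := congrArg (fun z : absIntegers (𝓞 (CyclotomicField m ℚ)) (CyclotomicField m ℚ) =>
      (z : AlgebraicClosure (CyclotomicField m ℚ))) (h1 (algebraMap _ _ x))
    simp only [absIntegersEquiv_apply, coe_absIntegersMap] at h2
    rw [h2, hcoe]
  ext x
  rw [Ideal.mem_pointwise_smul_iff_inv_smul_mem]
  change algebraMap _ _ x ∈ Ideal.comap ιi (γ • 𝔓) ↔ algebraMap _ _ (σt⁻¹ • x) ∈ Ideal.comap ιi 𝔓
  rw [Ideal.mem_comap, Ideal.mem_comap, Ideal.mem_pointwise_smul_iff_inv_smul_mem, hkey]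

end Literature.NumberTheory.GaloisRepresentations

end
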